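import Summits.QuantumFields.YangMills.Theorems.BalabanUVNodesN15CovariantLandauFlatTwoGridRowsKing
import Summits.QuantumFields.YangMills.Theorems.BalabanUVNodesN15KingModelSrcDivReflection
import HarnessLib

/-!
# Route «BalabanUVNodes», node N15 = NE2, road (c) — THE FLAT **TWO-GRID** KERNEL ROW OF THE **FORWARD** RIGHT ENTRY `G′(1)∘∇⁺_μ` ON KING's TORUS FAMILY
# (dag-n15-a g40, (Ξ-7); the by-name ASK «Ξ-4b» of dag-n15-c g37 for the (PC) site instantiation of the adjoint arrangement, entry 2 of (3.42))

Cell `pub-ymgap`, seat `pub-ymgap-dag-n15-a` (generation g40; KNIT-BY-NAME lane; HUMAN RULING D-0062; chair R424 venue).  `bears_on: R4∕N15 · K3⁸ SpineGivenEndpointR13SepCoPHV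
(stmt-QuantumFields-27366)`; filed `--supports stmt-QuantumFields-27366 --as helper` — COUNT-NEUTRAL.  Theorems only; 0 `def`; 0 `sorry`; HYPOTHESIS-FREE on King's torus
family `M_μ = 2L^e`, coarse run `N = L^K` (`K ≥ 1`), fine run `N′ = L^nL^K` (`n ≥ 1`), `L` odd `≥ 3`, `a₀ > 0`, rate exponent `0 ≤ γ < 1∕2` — the currency of
(Ξ-1) `…CovariantLandauFlatTwoGridRowsKing` ∕ (Ξ-4) `…CovariantLandauFlatRowsAllKing`.  Imports BY NAME: (Ξ-1) (`hasMaj_of_kingDecay_nat`, `idef_pull_liftMap_tensorId`,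
`rpow_rate_pow`; through it n15-c∕220 `cGreen_one`, `greenFlat_eq_fineOp_inv`, `mulVecLin_kronecker_one_rect`, dag-n15-a `abs_le_of_Ioc`, n15-c g7
`continuousAt_fineOp_inv_mulVec_mass`, M4 `hasMaj_tensorId`, dag-n15-e ★ `fullPropAdjOp_rate_printed`, `blockOf_underPtN`) and dag-n15-d FILE 66
`…KingModelSrcDivReflection` (the block-face reflection dictionary: `fineOp_inv_torRefl`, `kingPr_torRefl`, `blockOf_torRefl`, `tdistT_torRefl`; through it dag-n15-a N-Ia
`torRefl`, `torRefl_torRefl`, `torRefl_sub_unitVec_same`, `sum_torRefl`).  Nothing in the tree is modified; nothing restated.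

WHY.  dag-n15-c g37's (PC) site instantiation of the adjoint arrangement (entry 2 of (3.42) for THE named scalar covariant Green's function on the printed per-cube class,
n15-c∕427) needs, per cube and direction `μ`, the flat two-grid η-defects of BOTH sandwiched right entries of the plateau-compressed torus Green's function: the
BACKWARD one `G′(1)∘∇⁻_μ` is (Ξ-4)'s row `G′(1)∂ᵀ` + n15-c∕282a; the FORWARD one `G′(1)∘∇⁺_μ` is NOT derivable from it by `HasMaj` algebra (`∇⁺ = ∇⁻∘S` puts the shift on
the SOURCE, and the defect of the two one-step shifts through King's pairing is `O(1)` on rough sources).  THE DEVICE (dag-n15-d FILE 66∕67, here at the pointwise level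
of dag-n15-e's rung): King's `A₀ = ∂ᵀ∂ + a·Q*Q (+ m²)` is invariant under the block-face reflection `σ_μ` of the torus (`A₀⁻¹(σx, σy) = A₀⁻¹(x, y)`), `σ(σy − e_μ) =
y + e_μ`, and King's pairing commutes with `σ` — so `(A₀⁻¹N∇⁺_μλ)(x) = (A₀⁻¹N∇*_μ(λ∘σ))(σx)` on BOTH grids, with `(λ∘pr)∘σ′ = (λ∘σ)∘pr`: the forward row IS the rung's
third-entry rate `fullPropAdjOp_rate_printed` at the reflected source and the reflected point (`σ` is an isometry of the block torus, so the support∕decay datum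
transports), read at `m² → 0⁺` by continuity and tensored with `1_ι` exactly as (Ξ-1).
* §1 plumbing: `tensorId_comp_fgrad_liftEquiv` (the coloured forward gradient is the lift of the scalar one), `fwdSource_mulVec_torRefl` (the reflection identity
  `(A₀⁻¹·N(λ(· + e_μ) − λ))(x) = (A₀⁻¹·N((λ∘σ)(· − e_μ) − λ∘σ))(σx)`);
* §2 ★★★ `flatTwoGridRow_greenFgrad_king` — `∃ C δ > 0 ∀ K ≥ 1 ∀ n ≥ 1 ∀ e, M = 2L^e ∀ ι μ`:
  `HasMaj (ofBlocks (unitTorusGeo L K M) (liftBlk (blockOf (L^K) M) ι)) (ofBlocks … (liftBlk (blockOf (L^nL^K) M) ι)) (idef (pull (liftMap kingPr ι)) (pull (liftMap kingPr ι))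
  (cGreen″(1)∘fgrad″_μ) (cGreen′(1)∘fgrad′_μ)) (C·(L^K)^{−γ}·e^{−δ|y−y′|_T})` at the PAIRED masses `a_K(a₀,L,K)·(L^K)^{d+1}` ∕ `a_{n+K}(a₀,L,n+K)·(L^nL^K)^{d+1}`.

HONEST FRAMING ∕ LIMITS.  King's `A = 0` MODEL statement ([King1986] template literature, Prop. 3.8 (3.71) + Thm 3.3 (3.7), typed and proved in the tree by dag-n15-e) read on
Bałaban's flat objects at `U ≡ 1` through an exact dictionary and a lattice symmetry; periodic b.c., `K, n ≥ 1`, tori `2L^e`, odd `L ≥ 3`, `γ < 1∕2` (currency), King's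
PAIRED couplings; NOT [Balaban1985BackgroundPropagators] Thm 3.1 as printed (covariant, multiscale, weighted norms); NE2⁺ NOT PRINTED; N15 of record untouched (DISCHARGED
AS CONSUMED, p687738); counts UNMOVED (typed 28∕28 · discharged 8∕27); one finite 𝕋⁴ at fixed ε per index — NOT infinite volume ∕ OS ∕ mass gap ∕ Clay.  Restate-immune (no
Theses import).  No `sorry`, `instance`, `notation`; standard axioms.
-/

noncomputable section

open scoped BigOperators Matrix Kronecker

namespace Summit.QuantumFields.YangMills.BalabanUVNodes.N15.CovLandau

open Literature.MathematicalPhysics.QuantumFieldTheory.Balaban1983to89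
open Literature.MathematicalPhysics.QuantumFieldTheory.Balaban1983to89.B5Prop11Plancherel (Tor fine unitVec)
open Literature.MathematicalPhysics.QuantumFieldTheory.Balaban1983to89.B11SectG (BlockNorm HasMaj)
open Literature.MathematicalPhysics.QuantumFieldTheory.Balaban1983to89.B6UnitTorusCarrier (unitTorusGeo)
open Literature.MathematicalPhysics.QuantumFieldTheory.Balaban1983to89.T4EtaRateDefect (idef idef_apply)
open Literature.MathematicalPhysics.QuantumFieldTheory.Balaban1983to89.T4EtaRateCoeffDefect (pull pull_apply)
open Literature.MathematicalPhysics.QuantumFieldTheory.King1986 (aK aK_pos)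
open Literature.MathematicalPhysics.QuantumFieldTheory.King1986.Torus (blockOf tdistT tdistT_nonneg fineOp)
open Summit.QuantumFields.YangMills.BalabanUVNodes.N15.VectorPiece (tensorId tensorId_apply hasMaj_tensorId kingPr)
open Summit.QuantumFields.YangMills.BalabanUVNodes.N15.MatrixSpecies (liftBlk liftMap liftEquiv liftEquiv_apply)
open Summit.QuantumFields.YangMills.BalabanUVNodes.N15.BackgroundLayer (fgrad fgrad_apply)
open Summit.QuantumFields.YangMills.BalabanUVNodes.N15.TwoGrid (abs_le_of_Ioc torRefl torRefl_torRefl torRefl_sub_unitVec_same sum_torRefl)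
open Summit.QuantumFields.YangMills.BalabanUVNodes.N15.SiteLayerBg (continuousAt_fineOp_inv_mulVec_mass)
open Summit.QuantumFields.YangMills.BalabanUVNodes.N15KingModelRung.Curved (underPtN blockOf_underPtN fullPropAdjOp_rate_printed)
open Summit.QuantumFields.YangMills.BalabanUVNodes.N15.KingModel.SrcDiv (fineOp_inv_torRefl kingPr_torRefl blockOf_torRefl tdistT_torRefl)

variable {d : ℕ}

/-! ## §1 Plumbing: the coloured forward gradient is a lift; the block-face reflection turns the forward source difference into the backward one -/

section Plumbing

/-- **The coloured forward gradient is the Kronecker lift of the scalar one**: `(T ⊗ 1)∘fgrad n (s × id_ι) = (T∘fgrad n s) ⊗ 1` (forward twin of the tree's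
`tensorId_comp_fgradAdj_liftEquiv`). [folklore] -/
theorem tensorId_comp_fgrad_liftEquiv {X X₂ : Type} [Fintype X] [Fintype X₂] (ι : Type) (T : (X → ℝ) →ₗ[ℝ] (X₂ → ℝ)) (c : ℝ) (s : X ≃ X) :
    tensorId ι T ∘ₗ fgrad c (liftEquiv s ι) = tensorId ι (T ∘ₗ fgrad c s) := by
  refine LinearMap.ext fun f => funext fun p => ?_
  simp only [LinearMap.comp_apply, tensorId_apply]
  congr 1

/-- **THE REFLECTION IDENTITY FOR THE FORWARD SOURCE DIFFERENCE** (pointwise form of dag-n15-d FILE 66 `pull_torRefl_comp_kingSOp_comp`): for any `σ_κ`-invariant King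
operator `A₀ = c(−Δ) + m² + a·Q*Q` at any fineness, `(A₀⁻¹·(r(λ(· + e_κ) − λ)))(x) = (A₀⁻¹·(r((λ∘σ_κ)(· − e_κ) − λ∘σ_κ)))(σ_κx)` — `A₀⁻¹(σx, σy) = A₀⁻¹(x, y)` and
`σ(σy − e_κ) = y + e_κ`. [cite: King1986, (4.1)–(4.5) p.670; Balaban1984PropagatorsII, (2.37) p.229 (reflections)] -/
theorem fwdSource_mulVec_torRefl (N : ℕ) [NeZero N] (M : Fin (d + 1) → ℕ) [∀ μ, NeZero (M μ)] (κ : Fin (d + 1)) (a c m2 r : ℝ)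
    (lam : Tor (fine N M) → ℝ) (x : Tor (fine N M)) :
    ((fineOp N M a c m2)⁻¹ *ᵥ fun y => r * (lam (y + unitVec (fine N M) κ) - lam y)) x
      = ((fineOp N M a c m2)⁻¹ *ᵥ fun y => r * (lam (torRefl (fine N M) κ (y - unitVec (fine N M) κ)) - lam (torRefl (fine N M) κ y)))
          (torRefl (fine N M) κ x) := by
  simp only [Matrix.mulVec, dotProduct]
  symm
  rw [← sum_torRefl (κ := κ)]
  refine Finset.sum_congr rfl fun y _ => ?_
  rw [fineOp_inv_torRefl, torRefl_sub_unitVec_same, torRefl_torRefl]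

end Plumbing

/-! ## §2 The forward right-entry two-grid row from the King-model rung -/

section Row

variable (L : ℕ) [NeZero L]

/-- ★★★ **THE FLAT TWO-GRID ROW OF THE FORWARD RIGHT ENTRY `G′(1)∘∇⁺_μ`, HYPOTHESIS-FREE ON KING's TORUS FAMILY** (BS → BS; input and output pairing `kingPr`).  For odd
`L ≥ 3`, `a₀ > 0` and `0 ≤ γ < 1∕2` there are `C, δ > 0` such that for every `K ≥ 1`, `n ≥ 1`, every torus `M_μ = 2L^e`, every colour type `ι` and direction `μ`, at the
PAIRED masses `a_K·(L^K)^{d+1}` (coarse) ∕ `a_{n+K}·(L^nL^K)^{d+1}` (fine): the η-defect `(G″(1)∘N′∇″⁺_μ)(λ∘pr) − ((G′(1)∘N∇′⁺_μ)λ)∘pr` has the block majorant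
`C·(L^K)^{−γ}·e^{−δ|y−y′|_T}` — dag-n15-e's `fullPropAdjOp_rate_printed` (the `G∇*_μ` pair) at the `σ_μ`-REFLECTED source and point (§1 `fwdSource_mulVec_torRefl`; King's
pairing, the unit blocks and the block distance commute with `σ_μ`: dag-n15-d FILE 66), read at `m² → 0⁺` by continuity and tensored with `1_ι`.
[cite: King1986, Prop. 3.8 (3.71) p.664 (second line), Prop. 3.9 (3.73) p.665, Thm 3.3 (3.7) p.658, p.664 («x′ ∈ B^n(x)»), (4.1)–(4.5) p.670; Balaban1983RegularityDecay, Theorem (1.10) p.573; Balaban1985BackgroundPropagators, Thm 3.1 (3.42) p.397 (entry 2 at `U ≡ 1`: shape); Balaban1984PropagatorsII, (2.37) p.229 (reflections)] -/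
theorem flatTwoGridRow_greenFgrad_king (hLodd : Odd L) (hL : 2 ≤ L) {a₀ : ℝ} (ha₀ : 0 < a₀) {γ : ℝ} (hγ0 : 0 ≤ γ) (hγ1 : γ < 1 / 2) :
    ∃ C δ : ℝ, 0 < C ∧ 0 < δ ∧ ∀ (K : ℕ), 1 ≤ K → ∀ (n : ℕ), 1 ≤ n → ∀ (e : ℕ) (M : Fin (d + 1) → ℕ) [∀ μ, NeZero (M μ)], (∀ μ, M μ = 2 * L ^ e) →
      ∀ (ι : Type) [Fintype ι] [DecidableEq ι] (μ : Fin (d + 1)),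
        HasMaj (BlockNorm.ofBlocks (unitTorusGeo L K M) (liftBlk (blockOf (L ^ K) M) ι)) (BlockNorm.ofBlocks (unitTorusGeo L K M) (liftBlk (blockOf (L ^ n * L ^ K) M) ι))
          (idef (pull (liftMap (kingPr L K n M) ι)) (pull (liftMap (kingPr L K n M) ι))
            (Matrix.mulVecLin (cGreen M (L ^ n * L ^ K) (fun (_ : Fin (d + 1)) (_ : Tor (fine (L ^ n * L ^ K) M)) => (1 : Matrix ι ι ℝ))
                (aK a₀ (L : ℝ) (n + K) * ((L ^ n * L ^ K : ℕ) : ℝ) ^ (d + 1))) ∘ₗ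
              fgrad ((L ^ n * L ^ K : ℕ) : ℝ) (liftEquiv (Equiv.addRight (unitVec (fine (L ^ n * L ^ K) M) μ)) ι))
            (Matrix.mulVecLin (cGreen M (L ^ K) (fun (_ : Fin (d + 1)) (_ : Tor (fine (L ^ K) M)) => (1 : Matrix ι ι ℝ)) (aK a₀ (L : ℝ) K * ((L ^ K : ℕ) : ℝ) ^ (d + 1))) ∘ₗ
              fgrad ((L ^ K : ℕ) : ℝ) (liftEquiv (Equiv.addRight (unitVec (fine (L ^ K) M) μ)) ι)))
          (fun y y' => C * ((L : ℝ) ^ K) ^ (-γ) * Real.exp (-(δ * tdistT M y y'))) := by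
  obtain ⟨C, δ, hC, hδ, H⟩ := fullPropAdjOp_rate_printed (d := d) L hLodd hL ha₀ zero_le_one (γ := 2 * γ) (by linarith) (by linarith)
  refine ⟨C, δ, hC, hδ, ?_⟩
  intro K hK n hn e M _ hM ι _ _ μ
  rw [Nat.add_comm n K]
  have hL1r : (1 : ℝ) < L := by exact_mod_cast (lt_of_lt_of_le one_lt_two hL)
  have haK : 0 < aK a₀ (L : ℝ) K := aK_pos ha₀ hL1r hK
  have haK' : 0 < aK a₀ (L : ℝ) (K + n) := aK_pos ha₀ hL1r (le_add_right hK)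
  have hθ : 0 ≤ ((L : ℝ) ^ K) ^ (-γ) := Real.rpow_nonneg (pow_nonneg (Nat.cast_nonneg L) K) _
  -- the dictionary: both Green operators are King's massless inverses tensored with `1_ι`, the coloured forward gradients are lifts of the scalar ones
  rw [cGreen_one, cGreen_one, greenFlat_eq_fineOp_inv, greenFlat_eq_fineOp_inv, mulVecLin_kronecker_one_rect, mulVecLin_kronecker_one_rect,
    tensorId_comp_fgrad_liftEquiv, tensorId_comp_fgrad_liftEquiv, idef_pull_liftMap_tensorId]
  have hrow := hasMaj_of_kingDecay_nat L K (blockOf (L ^ K) M) (blockOf (L ^ n * L ^ K) M)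
    (idef (pull (kingPr L K n M)) (pull (kingPr L K n M))
      (Matrix.mulVecLin (fineOp (L ^ n * L ^ K) M (aK a₀ (L : ℝ) (K + n)) ((((L ^ n * L ^ K : ℕ) : ℝ)) ^ 2) 0)⁻¹ ∘ₗ
        fgrad ((L ^ n * L ^ K : ℕ) : ℝ) (Equiv.addRight (unitVec (fine (L ^ n * L ^ K) M) μ)))
      (Matrix.mulVecLin (fineOp (L ^ K) M (aK a₀ (L : ℝ) K) ((((L ^ K : ℕ) : ℝ)) ^ 2) 0)⁻¹ ∘ₗ
        fgrad ((L ^ K : ℕ) : ℝ) (Equiv.addRight (unitVec (fine (L ^ K) M) μ))))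
    (C := C * ((L : ℝ) ^ K) ^ (-γ)) (δ := δ) (mul_nonneg hC.le hθ) ?_
  · exact hasMaj_tensorId ι (fun y y' => by positivity) hrow
  intro lam F D hF x' hDx
  rw [idef_apply, Pi.sub_apply, pull_apply, LinearMap.comp_apply, LinearMap.comp_apply, Matrix.mulVecLin_apply, Matrix.mulVecLin_apply]
  -- the two forward sources, written out
  have hsf : fgrad ((L ^ n * L ^ K : ℕ) : ℝ) (Equiv.addRight (unitVec (fine (L ^ n * L ^ K) M) μ)) (pull (kingPr L K n M) lam)
      = fun y' => ((L ^ n * L ^ K : ℕ) : ℝ) * ((pull (kingPr L K n M) lam) (y' + unitVec (fine (L ^ n * L ^ K) M) μ) - (pull (kingPr L K n M) lam) y') := by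
    funext y'; rw [fgrad_apply, Equiv.coe_addRight]
  have hsc : fgrad ((L ^ K : ℕ) : ℝ) (Equiv.addRight (unitVec (fine (L ^ K) M) μ)) lam
      = fun y => ((L ^ K : ℕ) : ℝ) * (lam (y + unitVec (fine (L ^ K) M) μ) - lam y) := by
    funext y; rw [fgrad_apply, Equiv.coe_addRight]
  rw [hsf, hsc, fwdSource_mulVec_torRefl, fwdSource_mulVec_torRefl]
  -- the reflected sources are the rung's backward sources of `λ∘σ`; the reflected coarse point is the pairing of the reflected fine point
  simp only [pull_apply, kingPr_torRefl]
  have hpt : torRefl (fine (L ^ K) M) μ (kingPr L K n M x') = kingPr L K n M (torRefl (fine (L ^ n * L ^ K) M) μ x') := (kingPr_torRefl L M μ K n x').symm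
  rw [hpt]
  -- the support datum transports: `σ` is an isometry of the block torus and commutes with the blocks and the pairing
  have hsupp : ∀ y, (lam ∘ torRefl (fine (L ^ K) M) μ) y ≠ 0 →
      (D : ℝ) ≤ tdistT M (blockOf (L ^ K) M (underPtN L K n M (torRefl (fine (L ^ n * L ^ K) M) μ x'))) (blockOf (L ^ K) M y) := by
    intro y hy
    have h1 := hDx (torRefl (fine (L ^ K) M) μ y) hy
    have h2 : blockOf (L ^ K) M y = torRefl M μ (blockOf (L ^ K) M (torRefl (fine (L ^ K) M) μ y)) := by rw [blockOf_torRefl, torRefl_torRefl]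
    calc (D : ℝ) ≤ tdistT M (blockOf (L ^ n * L ^ K) M x') (blockOf (L ^ K) M (torRefl (fine (L ^ K) M) μ y)) := h1
      _ = tdistT M (blockOf (L ^ K) M (underPtN L K n M (torRefl (fine (L ^ n * L ^ K) M) μ x'))) (blockOf (L ^ K) M y) := by
          rw [blockOf_underPtN, blockOf_torRefl (L ^ n * L ^ K) M μ x', h2, tdistT_torRefl]
  -- the massless statement from the massive family by continuity at `m² = 0`
  have hc : ContinuousAt (fun m2 : ℝ =>
      ((fineOp (L ^ n * L ^ K) M (aK a₀ (L : ℝ) (K + n)) ((((L ^ n * L ^ K : ℕ) : ℝ)) ^ 2) m2)⁻¹ *ᵥ fun y' => ((L ^ n * L ^ K : ℕ) : ℝ) *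
          (lam (torRefl (fine (L ^ K) M) μ (kingPr L K n M (y' - unitVec (fine (L ^ n * L ^ K) M) μ))) - lam (torRefl (fine (L ^ K) M) μ (kingPr L K n M y'))))
        (torRefl (fine (L ^ n * L ^ K) M) μ x')
      - ((fineOp (L ^ K) M (aK a₀ (L : ℝ) K) ((((L ^ K : ℕ) : ℝ)) ^ 2) m2)⁻¹ *ᵥ fun y => ((L ^ K : ℕ) : ℝ) *
          (lam (torRefl (fine (L ^ K) M) μ (y - unitVec (fine (L ^ K) M) μ)) - lam (torRefl (fine (L ^ K) M) μ y)))
        (kingPr L K n M (torRefl (fine (L ^ n * L ^ K) M) μ x'))) 0 :=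
    (continuousAt_fineOp_inv_mulVec_mass M (L ^ n * L ^ K) haK' _ _).sub (continuousAt_fineOp_inv_mulVec_mass M (L ^ K) haK _ _)
  have hk := abs_le_of_Ioc one_pos hc fun m2 hm2 hm2' =>
    H K hK n hn e M hM m2 hm2 hm2' μ (lam ∘ torRefl (fine (L ^ K) M) μ) F (fun y => hF _) D (torRefl (fine (L ^ n * L ^ K) M) μ x') hsupp
  rw [rpow_rate_pow] at hk
  simpa only [mul_assoc, Function.comp_apply] using hk

end Row

end Summit.QuantumFields.YangMills.BalabanUVNodes.N15.CovLandau

end
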